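import Literature.AlgebraicGeometry.HodgeTheory.GysinFormalismOfResolutions
import Literature.AlgebraicGeometry.HodgeTheory.ComplexOrientationFamily
import HarnessLib

/-!
# Fulton's degree formula and Voisin's Lemma 9.18 for the complex orientations (named facts), and
# the resulting Hodge-compatible Gysin / cycle-class formalism

Family `hodge`, layer `Literature/AlgebraicGeometry/HodgeTheory`. The tree now has, as REAL objects,
the Gysin morphisms `complexGysin μ` (`HodgeTheory/ComplexGysin`), the cycle classes through
desingularisations `cycleClass μ` (`HodgeTheory/CycleClassOfResolutions`, Voisin I §11.1.4) and the
complex orientation family `complexOrientationFamily` (`HodgeTheory/ComplexOrientationFamily`: `X(ℂ)`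
oriented by its positive holomorphic algebraic atlas, complexified and normalised to the complexified
rational fundamental class), and it has PROVED that a Hodge-compatible `GysinFormalism` exists for
every orientation family with rational fundamental classes satisfying two classical identities
(`exists_gysinFormalism_isGysinHodgeCompatible`, `HodgeTheory/GysinFormalismOfResolutions`). This file
records those two identities FOR THE COMPLEX ORIENTATIONS as named facts (D-0014) — they are theorems
in print and genuinely depend on the orientations being the complex ones:

* `Fulton1998_degreeFormula_complexOrientation` — W. Fulton, *Intersection Theory* (1998),
  **Lemma 19.1.2** (p. 371): "Let `f : V → W` be a proper, surjective morphism of varieties. Then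
  `f_* cl(V) = deg(V/W) · cl(W)`" (`deg(V/W) = [R(V) : R(W)]`, §1.4), together with §19.1 "`cl` commutes
  with push-forward for proper morphisms": on the tree's carriers (closed manifolds only, classes pushed
  into a smooth projective ambient `X ⊇ W`, `cl(W) := τ_* 1` through a desingularisation `τ : W̃ → W`,
  Voisin I §11.1.4) this is `complexOrientationFamily.HasDegreeFormula`:
  `g_* 1_V = k • τ_* 1_{W̃}` whenever `g_*[V] = k [W]`, `k ≥ 1`, `τ_*[W̃] = [W]`.
* `Voisin2003_cycleClass_div_eq_zero_complexOrientation` — C. Voisin, *Hodge Theory and Complex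
  Algebraic Geometry II* (2003), **Lemma 9.18** (p. 234): "If `Z` is rationally equivalent to `0`,
  then `[Z] = 0`", in generator form (`Rat_d X` is generated by the `div φ`, `φ ∈ K(W)ˣ`,
  `W ⊆ X` closed of dimension `d + 1`, Fulton §1.3): `complexOrientationFamily.CycleClassDivEqZero`,
  `[div φ] = Σ_P ord_P(φ) • τ_P* 1 = 0`.

Both are insensitive to the sign convention `ε(n) = ±1` of `complexOrientationInt` (every term of each
identity is a Gysin image from a `d`-fold into the `n`-fold `X`, rescaled by the same `ε(d) ε(n)`).

PROVED here: `hasRationalFundamentalClasses_complexOrientationFamily` (from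
`exists_coeffChange_fundamentalClass_eq_complexOrientationFamily`), and the assembly
`exists_gysinFormalism_isGysinHodgeCompatible_complexOrientation` — **granted the two facts, a
`GysinFormalism` with Hodge-compatible Gysin morphisms exists whose Gysin maps are
`complexGysin complexOrientationFamily` and whose cycle classes are `cycleClass complexOrientationFamily`**;
hence every consumer of `(G : GysinFormalism) (hG : G.IsGysinHodgeCompatible)` (the Bloch–Srinivas
theorem `BlochSrinivas1983_…_of_gysinHodgeCompatible`, the cubic / quartic / quintic fourfold cases of
the Hodge conjecture) holds granted Fulton's Lemma 19.1.2 and Voisin's Lemma 9.18.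

## References

* [Fulton1998] W. Fulton, Intersection Theory, 2nd ed., Springer 1998, §1.3, §1.4, Lemma 19.1.2, §19.1.
* [VoisinHodgeII2003] C. Voisin, Hodge Theory and Complex Algebraic Geometry II, CUP 2003, Lemma 9.18,
  Prop. 9.21 (ii).
* [VoisinHodgeI2002] C. Voisin, Hodge Theory and Complex Algebraic Geometry I, CUP 2002, §7.3.2, §11.1.2,
  §11.1.4.
* [MilnorStasheff1974] J. Milnor, J. Stasheff, Characteristic Classes, PUP 1974, §13 p. 151.
-/

noncomputable section

open CategoryTheory AlgebraicGeometry
open Literature.AlgebraicTopology.SingularHomology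

namespace Literature.AlgebraicGeometry.HodgeTheory

section HodgeTheory

/-! ### The two named facts -/

/-- **Fulton's degree formula for the complex orientations** (named fact): W. Fulton, *Intersection
Theory*, Lemma 19.1.2 — "Let `f : V → W` be a proper, surjective morphism of varieties. Then
`f_* cl(V) = deg(V/W) · cl(W)`", with §19.1 "`cl` commutes with push-forward for proper morphisms" — read
on the closed manifolds `X(ℂ)` of smooth projective complex varieties through a desingularisation of
`W` (Voisin I §11.1.4): for the Gysin morphisms `complexGysin complexOrientationFamily`, `g_* 1_V = k • τ_* 1_{W̃}`
in `H^{2e}(X(ℂ); ℂ)` whenever `g : V ⟶ X`, `τ : W̃ ⟶ X` are morphisms from smooth projective `d`-folds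
with `g_*[V] = k [closure {z}]`, `k ≥ 1`, and `τ_*[W̃] = [closure {z}]` (Mathlib's weighted push-forward
of cycles; `k = [K(V) : K(closure {z})]`) — the predicate `OrientationFamily.HasDegreeFormula` of
`HodgeTheory/CycleClassOfResolutions` at the complex orientation family (for which alone it holds: its
content is that holomorphic maps have local degree `+1`, Milnor–Stasheff §13).
[cite: Fulton1998, Lemma 19.1.2 and §19.1] [cite: MilnorStasheff1974, §13 p. 151] -/
def Fulton1998_degreeFormula_complexOrientation : Prop :=
  complexOrientationFamily.HasDegreeFormula

/-- **Voisin's Lemma 9.18 for the complex orientations** (named fact): C. Voisin, *Hodge Theory and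
Complex Algebraic Geometry II*, Lemma 9.18 — "If `Z` is rationally equivalent to `0`, then `[Z] = 0`" —
for the cycle class `[Z] = Σ nᵢ τᵢ_* 1` through desingularisations (Voisin I §11.1.4, the tree's
`cycleClass`) and the complex orientation family, in generator form: for `X` smooth projective of
dimension `d + e`, every resolution family, every closed subvariety `W ⊆ X` of dimension `d + 1` and
`φ ∈ K(W)`, `φ ≠ 0`, the `d`-cycle `div φ` (Fulton §1.3) has `[div φ] = 0` in `H^{2e}(X(ℂ); ℂ)` — the
predicate `OrientationFamily.CycleClassDivEqZero` of `HodgeTheory/CycleClassOfResolutions` at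
`complexOrientationFamily`. [cite: VoisinHodgeII2003, Lemma 9.18] [cite: Fulton1998, §1.3] -/
def Voisin2003_cycleClass_div_eq_zero_complexOrientation : Prop :=
  complexOrientationFamily.CycleClassDivEqZero

/-! ### Consequences -/

/-- **The complex orientation family has rational fundamental classes**: `[X(ℂ)] = ι_*[X(ℂ)]_ℚ`
(`exists_coeffChange_fundamentalClass_eq_complexOrientationFamily`). [cite: VoisinHodgeI2002, §7.3.2] -/
theorem hasRationalFundamentalClasses_complexOrientationFamily :
    complexOrientationFamily.HasRationalFundamentalClasses := fun _ _ hX ↦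
  exists_coeffChange_fundamentalClass_eq_complexOrientationFamily hX

/-- **The Gysin morphisms of the complex orientation family preserve rational classes.**
[cite: VoisinHodgeI2002, §7.3.2] -/
theorem isRationalClass_complexGysin_complexOrientationFamily {m n : ℕ} {Y X : Motives.SchemeOver ℂ}
    (hY : Motives.IsSmoothProjective m Y) (hX : Motives.IsSmoothProjective n X) (f : Y ⟶ X)
    {a b : ℕ} (hab : a + 2 * n = b + 2 * m) {w : complexBetti Y a} (hw : IsRationalClass w) :
    IsRationalClass (complexGysin complexOrientationFamily hY hX f hab w) :=
  isRationalClass_complexGysin_of_hasRationalFundamentalClasses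
    hasRationalFundamentalClasses_complexOrientationFamily hY hX f hab hw

/-- **A Hodge-compatible Gysin / cycle-class formalism exists, granted Fulton's Lemma 19.1.2 and
Voisin's Lemma 9.18 for the complex orientations**: its Gysin morphisms are
`complexGysin complexOrientationFamily` and its cycle classes are `cycleClass complexOrientationFamily`
through resolution families (`exists_gysinFormalism_isGysinHodgeCompatible` at the complex orientation
family, whose fundamental classes are rational). Every consumer of
`(G : GysinFormalism) (hG : G.IsGysinHodgeCompatible)` therefore holds granted the two named facts.
[cite: Fulton1998, Lemma 19.1.2] [cite: VoisinHodgeII2003, Lemma 9.18 and Prop. 9.21 (ii)]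
[cite: VoisinHodgeI2002, §7.3.2 and §11.1.4] -/
theorem exists_gysinFormalism_isGysinHodgeCompatible_complexOrientation
    (hB : Fulton1998_degreeFormula_complexOrientation)
    (hC : Voisin2003_cycleClass_div_eq_zero_complexOrientation) :
    ∃ G : GysinFormalism, G.IsGysinHodgeCompatible ∧
      (∀ ⦃m n : ℕ⦄ ⦃Y X : Motives.SchemeOver ℂ⦄ (hY : Motives.IsSmoothProjective m Y)
        (hX : Motives.IsSmoothProjective n X) (f : Y ⟶ X) ⦃a b : ℕ⦄ (hab : a + 2 * n = b + 2 * m),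
          G.gysin hY hX f hab = complexGysin complexOrientationFamily hY hX f hab) ∧
      (∀ ⦃n : ℕ⦄ ⦃X : Motives.SchemeOver ℂ⦄ (hX : Motives.IsSmoothProjective n X) ⦃d e : ℕ⦄
        (hde : d + e = n), ∃ ρ : ResolutionFamily X d,
          G.cl hX hde = cycleClass complexOrientationFamily hX hde ρ) :=
  exists_gysinFormalism_isGysinHodgeCompatible hB hC
    hasRationalFundamentalClasses_complexOrientationFamily

end HodgeTheory

end Literature.AlgebraicGeometry.HodgeTheory

end
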